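import Summits.CriticalPhenomena.PercolationContinuityZ3.Theorems.PercNearOneGluingNoHeavyLowerTailSuperTerminalP3LamAFreePieces
import HarnessLib

/-!
# The pendant form `AF¹` of the `a`-free gluing criterion: `AF¹ ⟹ C`, and pendant stability (cell algebra)

Support file for crux `stmt-CriticalPhenomena-4575` (`NoHeavyLowerTail`), seat `prim-l12-p1` gen 33 (`--supports stmt-CriticalPhenomena-4575`);
sequel of `…SuperTerminalP3LamAFreePieces` / `…AFreeJoin`.  No definitions, no sorries, standard axioms.

For an `a`-free piece with 3-point law `(n, p_sb, p_sc, p_bc, p_all)` (port `c`), write `t = p_sc`, `u = p_bc`, `N₀ = n+t+u = P(s≁b)`,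
`k = t+u+p_all = P(c ↔ {s,b})`; in down-set coordinates `t = e4 − e0`, `u = e2 − e0`, `N₀ = e2 + e4 − e0`, `k = 1 − e7`.  The PENDANT FORM of the
criterion is the pair of quadratics (`a = λ − 1`)
`AF¹_τ(γ) = a(a(t+u) + t) + γ[2a(t+u) + (1−a)t − λN₀k] + γ²u ≥ 0`, `AF¹_ζ(γ)` = the same with `t ↔ u`.
* `crit_of_afOne` — **`AF¹(γ) ⟹ C(γ)`**: the slack of `C(γ)` equals `AF¹(γ) + γ(1−γ)·k·u` (resp. `·t`) — two ring identities;
* `afOne_pendant` — **pendant stability**: hanging the port on a new pendant edge of probability `w` (cells `n ↦ n + (1−w)(t+u)`, `t ↦ wt`, `u ↦ wu`,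
  `k ↦ wk`, `N₀` fixed) multiplies `AF¹` by `w`;
* `crit_pendant` — hence `AF¹(γ)` for a law gives `C(γ)` for ALL its pendant extensions (conversely `C` for all pendant extensions forces `AF¹`,
  since after division by `w` the slack is affine in `w`; memo §10.1).
For `λ = 3/2`, `AF¹` for all `γ ∈ [0,1]` is equivalent to the closed form **`P(s≁b)·P(c↔{s,b}) ≤ m + (2/3)M + (2/3)√(M²+3mM)`**, `m ≤ M` the two one-sided
attachments `t, u` (CONJECTURE AF¹ of memo `FROM-prim-l12-p1-g33-PORT-PART-SHARP-ROW.md` §10; it sharpens the face inequality `(C½)`, whose right side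
is `(3/2)(m+M)`, by the asymmetry of the port's attachments, and implies CONJECTURE AF of §9).
-/

namespace Summit.CriticalPhenomena.PercolationContinuityZ3.Theorems.SuperTerminalP3LamAFreePendant

/-- The gluing criterion `C(γ; n, N₂, N₄, ic)` of an `a`-free piece (as in `…SuperTerminalP3LamAFreePieces`).  Local notation only. -/
local notation "Crit[" lam ";" g ";" n "," N2 "," N4 "," ic "]" =>
  (((lam - 1 + g) * (n * (1 - g * ic) - (lam - 1 + g * ic) * (N2 + N4 - 2 * n)) ≤ (1 - g) * (lam - 1 + g * ic) * N2 ∧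
      (lam - 1 + g) * (n * (1 - g * ic) - (lam - 1 + g * ic) * (N2 + N4 - 2 * n)) ≤ (1 - g) * (lam - 1 + g * ic) * N4) : Prop)

/-- The pendant form `AF¹(γ; N₀, t, u, k)` (both versions).  Local notation only. -/
local notation "AFone[" lam ";" g ";" N0 "," t "," u "," k "]" =>
  ((0 ≤ (lam - 1) * ((lam - 1) * (t + u) + t) + g * (2 * (lam - 1) * (t + u) + (1 - (lam - 1)) * t - lam * N0 * k) + g ^ 2 * u ∧
      0 ≤ (lam - 1) * ((lam - 1) * (t + u) + u) + g * (2 * (lam - 1) * (t + u) + (1 - (lam - 1)) * u - lam * N0 * k) + g ^ 2 * t) : Prop)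

/-- **`AF¹(γ) ⟹ C(γ)`.**  In down-set coordinates (`t = e4−e0`, `u = e2−e0`, `N₀ = e2+e4−e0`, `k = 1−e7`): if `0 ≤ γ ≤ 1`, `e7 ≤ 1`, `e0 ≤ e2`,
`e0 ≤ e4` and `AF¹(γ)` holds then `C(γ; e0, e2, e4, e7)` holds — the slack of `C` is `AF¹ + γ(1−γ)(1−e7)(e2−e0)` resp. `… (e4−e0)`. [this work] -/
theorem crit_of_afOne {lam g e0 e2 e4 e7 : ℝ} (hg : 0 ≤ g) (hg1 : g ≤ 1) (he71 : e7 ≤ 1) (h02 : e0 ≤ e2) (h04 : e0 ≤ e4)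
    (h : AFone[lam; g; e2 + e4 - e0, e4 - e0, e2 - e0, 1 - e7]) : Crit[lam; g; e0, e2, e4, e7] := by
  obtain ⟨hτ, hζ⟩ := h
  have iτ : (1 - g) * (lam - 1 + g * e7) * e4 - (lam - 1 + g) * (e0 * (1 - g * e7) - (lam - 1 + g * e7) * (e2 + e4 - 2 * e0)) =
      ((lam - 1) * ((lam - 1) * (e4 - e0 + (e2 - e0)) + (e4 - e0)) +
          g * (2 * (lam - 1) * (e4 - e0 + (e2 - e0)) + (1 - (lam - 1)) * (e4 - e0) - lam * (e2 + e4 - e0) * (1 - e7)) + g ^ 2 * (e2 - e0)) +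
        g * (1 - g) * (1 - e7) * (e2 - e0) := by ring
  have iζ : (1 - g) * (lam - 1 + g * e7) * e2 - (lam - 1 + g) * (e0 * (1 - g * e7) - (lam - 1 + g * e7) * (e2 + e4 - 2 * e0)) =
      ((lam - 1) * ((lam - 1) * (e4 - e0 + (e2 - e0)) + (e2 - e0)) +
          g * (2 * (lam - 1) * (e4 - e0 + (e2 - e0)) + (1 - (lam - 1)) * (e2 - e0) - lam * (e2 + e4 - e0) * (1 - e7)) + g ^ 2 * (e4 - e0)) +
        g * (1 - g) * (1 - e7) * (e4 - e0) := by ring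
  have pζ : 0 ≤ g * (1 - g) * (1 - e7) * (e2 - e0) :=
    mul_nonneg (mul_nonneg (mul_nonneg hg (sub_nonneg.2 hg1)) (sub_nonneg.2 he71)) (sub_nonneg.2 h02)
  have pτ : 0 ≤ g * (1 - g) * (1 - e7) * (e4 - e0) :=
    mul_nonneg (mul_nonneg (mul_nonneg hg (sub_nonneg.2 hg1)) (sub_nonneg.2 he71)) (sub_nonneg.2 h04)
  constructor <;> linarith

/-- **Pendant stability of `AF¹` (exact scaling).**  Hanging the port on a pendant edge of probability `w` replaces `(t, u, k)` by `(wt, wu, wk)` and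
keeps `N₀`; both quadratics of `AF¹` get multiplied by `w`. [this work] -/
theorem afOne_pendant {lam g N0 t u k w : ℝ} (hw : 0 ≤ w) (h : AFone[lam; g; N0, t, u, k]) :
    AFone[lam; g; N0, w * t, w * u, w * k] := by
  obtain ⟨hτ, hζ⟩ := h
  have iτ : (lam - 1) * ((lam - 1) * (w * t + w * u) + w * t) + g * (2 * (lam - 1) * (w * t + w * u) + (1 - (lam - 1)) * (w * t) -
      lam * N0 * (w * k)) + g ^ 2 * (w * u) =
      w * ((lam - 1) * ((lam - 1) * (t + u) + t) + g * (2 * (lam - 1) * (t + u) + (1 - (lam - 1)) * t - lam * N0 * k) + g ^ 2 * u) := by ring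
  have iζ : (lam - 1) * ((lam - 1) * (w * t + w * u) + w * u) + g * (2 * (lam - 1) * (w * t + w * u) + (1 - (lam - 1)) * (w * u) -
      lam * N0 * (w * k)) + g ^ 2 * (w * t) =
      w * ((lam - 1) * ((lam - 1) * (t + u) + u) + g * (2 * (lam - 1) * (t + u) + (1 - (lam - 1)) * u - lam * N0 * k) + g ^ 2 * t) := by ring
  refine ⟨?_, ?_⟩
  · rw [iτ]; exact mul_nonneg hw hτ
  · rw [iζ]; exact mul_nonneg hw hζ

/-- **`AF¹` gives the criterion for every pendant extension.**  In down-set coordinates the pendant extension with edge probability `w` of an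
`a`-free piece `(e0, e2, e4, e7)` is `e0' = e0 + (1−w)(e2+e4−2e0)`, `e2' = e0' + w(e2−e0)`, `e4' = e0' + w(e4−e0)`, `e7' = 1 − w(1−e7)`; if the piece
satisfies `AF¹(γ)` then the extension satisfies `C(γ)`. [this work] -/
theorem crit_pendant {lam g e0 e2 e4 e7 w : ℝ} (hg : 0 ≤ g) (hg1 : g ≤ 1) (he71 : e7 ≤ 1) (h02 : e0 ≤ e2) (h04 : e0 ≤ e4)
    (hw : 0 ≤ w) (h : AFone[lam; g; e2 + e4 - e0, e4 - e0, e2 - e0, 1 - e7]) :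
    Crit[lam; g; e0 + (1 - w) * (e2 + e4 - 2 * e0), e0 + (1 - w) * (e2 + e4 - 2 * e0) + w * (e2 - e0),
      e0 + (1 - w) * (e2 + e4 - 2 * e0) + w * (e4 - e0), 1 - w * (1 - e7)] := by
  have hp := afOne_pendant (w := w) hw h
  refine crit_of_afOne hg hg1 (by nlinarith [mul_nonneg hw (sub_nonneg.2 he71)]) (by nlinarith [mul_nonneg hw (sub_nonneg.2 h02)])
    (by nlinarith [mul_nonneg hw (sub_nonneg.2 h04)]) ?_
  have e1 : e0 + (1 - w) * (e2 + e4 - 2 * e0) + w * (e2 - e0) + (e0 + (1 - w) * (e2 + e4 - 2 * e0) + w * (e4 - e0)) -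
      (e0 + (1 - w) * (e2 + e4 - 2 * e0)) = e2 + e4 - e0 := by ring
  have e2' : e0 + (1 - w) * (e2 + e4 - 2 * e0) + w * (e4 - e0) - (e0 + (1 - w) * (e2 + e4 - 2 * e0)) = w * (e4 - e0) := by ring
  have e3 : e0 + (1 - w) * (e2 + e4 - 2 * e0) + w * (e2 - e0) - (e0 + (1 - w) * (e2 + e4 - 2 * e0)) = w * (e2 - e0) := by ring
  have e4' : 1 - (1 - w * (1 - e7)) = w * (1 - e7) := by ring
  rw [e1, e2', e3, e4']
  exact hp

end Summit.CriticalPhenomena.PercolationContinuityZ3.Theorems.SuperTerminalP3LamAFreePendant
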